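import Summits.QuantumFields.YangMills.Theses.ParabolicTrajectory

/-!
# Sketch — first lemmas of the crux-idea cards for `LatticeGapOnTrajectory` (stmt-QuantumFields-10523)

Planner scratch (crux-ideate round 1, ideator 1). Nothing here is proposed to the tree; the decls
only have to ELABORATE over existing declarations. Three cards:

* `trajectory-gap-scaling`      — `ClustersOn`, `GapScalingFromChartPoint` (the lever, provable
                                   bookkeeping) and `OnePointOpenClustering` (the residual crux);
* `af-repeller-ir-rigidity`     — `ChartRepeller`, `NoReturnToFreePoint` (provable now from the
                                   fields of `BalabanBanachStep`);
* `physical-anchor-continuity`  — `FixedBetaToTrajectory` (adapter: what a fixed-β gap family must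
                                   additionally satisfy to give the lattice half of (B)).
-/

open scoped SchwartzMap
open MeasureTheory Filter Topology
open Literature.MathematicalPhysics.QuantumFieldTheory Literature.MathematicalPhysics.QuantumLattice

noncomputable section

namespace Summit.QuantumFields.YangMills.Cruxes.LatticeGapOnTrajectory.Sketch

variable {G : Type} [Group G] [TopologicalSpace G] [IsTopologicalGroup G] [CompactSpace G]
  [MeasurableSpace G] [BorelSpace G] {r : LatticeRep G} {M : ℕ}

/-! ## Card 1 — trajectory-gap-scaling -/

/-- Uniform exponential clustering, at rate `m` per UNIT-lattice time step, of the centred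
two-point functions of the effective theories at all chart points of `U` (constants depend on the
species pair and the test functions, NOT on the point of `U`, the torus or the separation). -/
def ClustersOn (S : BalabanBanachStep G r M) (U : Set (ℝ × S.E)) (m : ℝ) : Prop :=
  ∀ (σ : Fin 2 → YMSpecies G) (f g : 𝓢(EuclideanSpace ℝ (Fin 4), ℝ)),
    ∃ C : ℝ, ∃ T₁ : ℕ, ∀ p ∈ U, ∀ T : ℕ, T₁ ≤ T → ∀ t : ℕ, t ≤ T →
      |S.expect p (2 * T + 1) 2 σ ![f, timeShiftTest 4 (t : ℝ) g]| ≤ C * Real.exp (-(m * t))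

/-- **Gap scaling from one chart point** (the lever of card 1, provable bookkeeping): if the
effective theories cluster at rate `m` uniformly on a neighbourhood of a chart point `p₀`, then
along EVERY family of Wilson points `g k` whose `j k`-fold images under the step converge to `p₀`
(orbit segments inside the chart), the fine-lattice Wilson theories at inverse coupling
`betaOf (g k)` cluster, for `M^{j k}`-dilated test functions, at rate `m` per `M^{j k}` fine time
steps — i.e. at the PHYSICAL rate `m`, uniformly in `k`: a rate-free clustering property of ONE
neighbourhood becomes the scaling gap along the sequence (exact RG covariance `expect_iterate` +
identification `expect_wilson`). -/
def GapScalingFromChartPoint : Prop :=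
  ∀ (G : Type) [Group G] [TopologicalSpace G] [IsTopologicalGroup G] [CompactSpace G]
    [MeasurableSpace G] [BorelSpace G] (r : LatticeRep G) (M : ℕ) (S : BalabanBanachStep G r M)
    (p₀ : ℝ × S.E) (ε m : ℝ), 0 < ε → 0 < m →
    ClustersOn S (Metric.ball p₀ ε ∩ (Set.Icc 0 S.δ ×ˢ Metric.closedBall 0 S.R)) m →
    ∀ (g : ℕ → ℝ) (j : ℕ → ℕ),
      (∀ k, g k ∈ Set.Ioc 0 S.g₀) →
      (∀ k, ∀ i ≤ j k, (S.F^[i] (g k, S.yW (g k))).1 ∈ Set.Icc 0 S.δ ∧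
        ‖(S.F^[i] (g k, S.yW (g k))).2‖ ≤ S.R) →
      Tendsto (fun k => S.F^[j k] (g k, S.yW (g k))) atTop (𝓝 p₀) →
      ∀ (σ : Fin 2 → YMSpecies G) (f f' : 𝓢(EuclideanSpace ℝ (Fin 4), ℝ)),
        ∃ C : ℝ, ∃ T₁ : ℕ, ∀ᶠ k in atTop, ∀ T : ℕ, T₁ ≤ T → ∀ t : ℕ, t ≤ T →
          |wilsonCentredSchwinger r.ρ (S.betaOf (g k)) ((M ^ j k * (2 * T + 1) - 1) / 2)
              (S.c (g k)) 2 σ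
              ![(blockDilate M)^[j k] f, (blockDilate M)^[j k] (timeShiftTest 4 (t : ℝ) f')]|
            ≤ C * Real.exp (-(m * t))

/-- **The residual crux of card 1 (one-point open clustering on the trajectory)**: for every
`G, r` and large block factor `M` there is a realisation of Bałaban's step in which SOME point of
the centre-unstable curve (or of its forward orbit inside the basin) has a neighbourhood on which
the effective theories cluster exponentially at one positive rate — a RATE-FREE, k-free statement
about ONE family of unit-lattice gauge theories. -/
def OnePointOpenClustering : Prop :=
  ∀ (G : Type) [Group G] [TopologicalSpace G] [IsTopologicalGroup G] [CompactSpace G],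
    IsCompactSimpleLieGroup G →
    letI : MeasurableSpace G := borel G
    haveI : BorelSpace G := ⟨rfl⟩
    ∀ (r : LatticeRep G), ∃ M₀ : ℕ, ∀ M : ℕ, M₀ ≤ M →
      ∃ (S : BalabanBanachStep G r M) (p₀ : ℝ × S.E) (ε m : ℝ), 0 < ε ∧ 0 < m ∧
        p₀.1 ∈ Set.Ioc 0 S.δ ∧ ‖p₀.2‖ ≤ S.R ∧
        ClustersOn S (Metric.ball p₀ ε ∩ (Set.Icc 0 S.δ ×ˢ Metric.closedBall 0 S.R)) m ∧
        -- `p₀` is visited: every Wilson orbit started at small enough bare coupling passes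
        -- through the `ε/2`-ball of `p₀` while staying in the chart
        ∃ g₁ : ℝ, 0 < g₁ ∧ ∀ g : ℝ, 0 < g → g ≤ g₁ → ∃ j : ℕ,
          (∀ i ≤ j, (S.F^[i] (g, S.yW g)).1 ∈ Set.Icc 0 S.δ ∧ ‖(S.F^[i] (g, S.yW g)).2‖ ≤ S.R) ∧
          S.F^[j] (g, S.yW g) ∈ Metric.ball p₀ (ε / 2)

/-! ## Card 2 — af-repeller-ir-rigidity -/

/-- **Chart repeller** (provable now from `remainder`): near the free fixed point the coupling
coordinate strictly increases under one step, `g < φ g y` for `0 < g ≤ ρ`, `‖y‖ ≤ ρ`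
(`φ g y ≥ g + b g³ − C (g⁴ + g³ ‖y‖) > g` once `C (g + ‖y‖) < b`). Asymptotic freedom read
backwards: the free non-abelian fixed point is repelling in its only marginal direction. -/
def ChartRepeller : Prop :=
  ∀ (G : Type) [Group G] [TopologicalSpace G] [IsTopologicalGroup G] [CompactSpace G]
    [MeasurableSpace G] [BorelSpace G] (r : LatticeRep G) (M : ℕ) (S : BalabanBanachStep G r M),
    ∃ ρ : ℝ, 0 < ρ ∧ ρ ≤ S.δ ∧
      ∀ (g : ℝ) (y : S.E), 0 < g → g ≤ ρ → ‖y‖ ≤ ρ → g < S.φ g y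

/-- **No return to the free point** (corollary, provable now): no orbit of the step that stays in
the `ρ`-neighbourhood of the free fixed point and starts at positive coupling converges to the
free fixed point `(0, 0)` — so an infrared limit of the trajectory theories cannot be free
non-abelian glue INSIDE the chart (the rigidity line must then exclude free photons and
interacting dilation-covariant limits, and limits approaching the Gaussian point from outside
every chart). -/
def NoReturnToFreePoint : Prop :=
  ∀ (G : Type) [Group G] [TopologicalSpace G] [IsTopologicalGroup G] [CompactSpace G]
    [MeasurableSpace G] [BorelSpace G] (r : LatticeRep G) (M : ℕ) (S : BalabanBanachStep G r M),
    ∃ ρ : ℝ, 0 < ρ ∧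
      ∀ p : ℝ × S.E, 0 < p.1 →
        (∀ i : ℕ, (S.F^[i] p).1 ∈ Set.Ioc 0 ρ ∧ ‖(S.F^[i] p).2‖ ≤ ρ) →
        ¬ Tendsto (fun i => S.F^[i] p) atTop (𝓝 ((0 : ℝ), (0 : S.E)))

/-! ## Card 3 — physical-anchor-continuity (adapter lemma shared with card 2) -/

/-- **Fixed-β gap family ⇒ lattice half of (B)** (adapter, provable now by unfolding): a family of
volume-uniform weak-coupling lattice gaps `m β` (the shape of the shared target
`SmallCircleAnchor.UniformLatticeGap`) gives `HasLatticeMassGap r sch Δ₀` along a tuned `M`-adic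
Wilson sequence PROVIDED three extra things hold, which are exactly what (B) demands beyond a
rate-free gap: (U1) per-pair constants uniform in `β`, (U2) the SCALING FLOOR
`Δ₀ ≤ m (β_k) · M^{n_k}` (the gap is at least `Δ₀` per tuning length `D_k = M^{n_k} = a_k⁻¹`),
(U3) the volume threshold `S₁ (β_k) ≤ L_k` eventually. -/
def FixedBetaToTrajectory : Prop :=
  ∀ (G : Type) [Group G] [TopologicalSpace G] [IsTopologicalGroup G] [CompactSpace G]
    [MeasurableSpace G] [BorelSpace G] (r : LatticeRep G) (M : ℕ)
    (sch : SpeciesScheme (YMSpecies G)) (n : ℕ → ℕ) (m : ℝ → ℝ) (S₁ : ℝ → ℕ) (β₁ Δ₀ : ℝ),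
    0 < Δ₀ →
    (∀ A B : YMSpecies G, ∃ C : ℝ, ∀ β : ℝ, β₁ ≤ β → ∀ S t : ℕ, S₁ β ≤ S → t ≤ S →
      |latticeConnectedCorr r.ρ β (2 * S + 1) A.F B.F t| ≤ C * Real.exp (-(m β * t))) →
    (∀ k, sch.a k = ((M : ℝ) ^ n k)⁻¹) →
    Tendsto sch.β atTop atTop →
    (∀ᶠ k in atTop, Δ₀ ≤ m (sch.β k) * (M : ℝ) ^ n k) →
    (∀ᶠ k in atTop, S₁ (sch.β k) ≤ sch.L k) →
    HasLatticeMassGap r sch Δ₀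

/-- Sanity: the adapter's conclusion is literally the lattice conjunct of the crux. -/
example (h : Summit.QuantumFields.YangMills.Theses.ParabolicTrajectory.LatticeGapOnTrajectory) :
    Summit.QuantumFields.YangMills.Theses.ParabolicTrajectory.LatticeGapOnTrajectory := h

end Summit.QuantumFields.YangMills.Cruxes.LatticeGapOnTrajectory.Sketch

end
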